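import Summits.BirchSwinnertonDyer.BirchSwinnertonDyer.Theorems.KatoDescentPotSupersingularReducibleFineSelmerMuZeroCharForm
import Literature.NumberTheory.IwasawaTheory.ClassicalMuVanishesUnramifiedClassesProofs
import Literature.NumberTheory.IwasawaTheory.ClassicalMuVanishesReflectionDescent
import HarnessLib

/-!
# (A) at `p = 3` on the REDUCIBLE rows from `μ₃ = 0` of the IMAGINARY QUADRATIC MIRROR ALONE — the `μ`-input of crux M
# halved by Leopoldt–Scholz reflection (route-free helper for crux M = stmt-BirchSwinnertonDyer-19196 `ReducibleKatoMember`,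
# K9 `KatoDescentPotSupersingular` / K8-t′ `KatoDescentTamePotSupersingular`; seat `bsd-potss-rkm` g36)

WHY.  After g34/g35 the kernel trust base of crux M on ALL its rows is {`exists_isNewformOf`, Fine, H2X⁺, FW}, and FW
(`IwasawaTheory.ferreroWashington1979_classicalMuVanishes`) enters at exactly one place: `ClassicalMuVanishes` for the cyclotomic
`ℤ_p`-tower of the Borel field `ℚ(χ₁, χ₂)` of the stable line (g33's dévissage
`ReducibleFineSelmerMuZeroCharForm.fineSelmerInfty_torsion_finite_of_reducible`).  Since `χ₁χ₂ = ω`, `{χ₁, χ₂}` is a LEOPOLDT MIRROR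
PAIR; at `p = 3` the Borel field is the CM biquadratic field `L = ℚ(√d, √−3) ∋ ζ₃` with quadratic subfields `ℚ(√d)` (real or
imaginary), `ℚ(ζ₃)`, `ℚ(√−3d)`.  The Literature theorem `classicalMuVanishes_of_isCyclotomic_of_imaginaryMirror_three` (this seat,
`IwasawaTheory/ClassicalMuVanishesReflectionDescent.lean`: Lang Ch. 13 Thm. 2.1 (i) + Kuroda + «μ = 0 ⟺ bounded p-ranks» + Iwasawa
1956, all tree theorems) gives `μ₃(L) = 0` from «`μ = 0` for the cyclotomic `ℤ₃`-tower of the IMAGINARY mirror `L^{⟨zb⟩}`» ALONE —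
the real mirror's `μ = 0` is reflection, `ℚ(ζ₃)`'s is Iwasawa 1956, `ℚ`'s likewise.  This file composes it with g33's dévissage:

* `fineSelmerInfty_torsion_finite_three_of_imaginaryMirror` — `Sel₀(ℚ_∞, W[3])` is finite for `W/ℚ` with a stable line `C`, given
  the Galois data of the Borel field (`z` = complex conjugation, `b` the involution fixing `ℚ(ζ₃)`, `Gal = ⟨z, b⟩`) and «`μ = 0` for
  every cyclotomic `ℤ₃`-extension of the imaginary mirror `(borelField C)^{⟨zb⟩}`»;
* `fineSelmerDual_moduleFinite_three_of_imaginaryMirror` — the same in Coates–Sujatha's (A) spelling `∃ γ D, Module.Finite ℤ_[3] D.X`;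
* `fineSelmerDual_moduleFinite_three_of_imaginaryMirror_iwasawa1956` — THE PER-ROW DOOR: the mirror input discharged by Iwasawa's
  1956 criterion on the imaginary quadratic mirror ALONE (`3 ∤ h` and one prime above `3`; NO condition on the real field).

CENSUS (kit j327502, HOME/rkm/g36/K9-X3-mirror3-census-g36.tsv): of the 9476 K9 O6 X3 r0 classes, 4865 are cyclotomic-Borel (g35,
FW idle); of the other 4611, the biquadratic Iwasawa-1956 door of g35 covers 3131 and the mirror door 3518 (+387, never fewer); the
remaining 1093 classes have only 18 distinct imaginary mirror fields `ℚ(√δ)` (all with `3` split or `3 ∣ h`), so FW-freeness of M's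
`μ`-input on ALL 9476 classes is now 18 rank-stability certificates away (Fukuda, tree `fukuda1994_thm1_…_holds`).

HONEST FRAMING.  Theorems only; route-free; closes nothing (crux M stays cite-level over Fine, H2X⁺, modularity, and — class-wide —
FW in its imaginary-quadratic instance); the Galois data of the Borel field are DISPLAYED hypotheses (their discharge from the row, and the
transport of the Borel field to Kato's member, are left to the record lanes / a successor); BSD is proved for no curve.

References: [Lang1990] Ch. 13 §2 Thm. 2.1 (i); [Washington1997] §10.2 Thm. 10.10 (Scholz), §13.3 Prop. 13.23; [Lemmermeyer1994] §1;
[CoatesSujatha2005] Cor. 3.6; [Wuthrich2014] Lemma 14; [Greenberg2001IwasawaPastPresent] Prop. 2.1; tree g33/g34/g35 files of this seat.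
-/

-- the summit and its single problem are both named `BirchSwinnertonDyer` (registry layout D-0017)
set_option linter.dupNamespace false
set_option autoImplicit false

noncomputable section

open scoped Classical NumberField
open Field NumberField IsDedekindDomain IntermediateField WeierstrassCurve
open Literature.NumberTheory.EllipticCurves Literature.NumberTheory.EllipticCurves.GreenbergSelmer
open Literature.NumberTheory.GaloisRepresentations Literature.NumberTheory.IwasawaTheory
open Literature.NumberTheory.IwasawaTheory.ClassicalMuVanishesUnramifiedClasses
open Summit.BirchSwinnertonDyer.BirchSwinnertonDyer.Theorems

namespace Summit.BirchSwinnertonDyer.BirchSwinnertonDyer.Theorems.ReducibleFineSelmerMirrorThree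

/-- **`Sel₀(ℚ_∞, W[3])` is finite on a reducible row at `p = 3` from `μ₃ = 0` of the IMAGINARY QUADRATIC MIRROR alone.**  `W/ℚ`
elliptic, `C ≤ W[3]` a stable line, `L = borelField C = ℚ(χ₁, χ₂)` its Borel field with displayed Galois data: `L` totally complex,
`3 ∤ [L : ℚ]`, a primitive cube root of unity `ζ ∈ L`, commuting involutions `z, b` generating `Gal(L/ℚ)` with `z ≠ 1`, `L^{⟨z⟩}` totally
real and `L^{⟨b⟩}` a `3`rd cyclotomic extension of `ℚ`; INPUT: `μ = 0` (growth form) for every cyclotomic `ℤ₃`-extension of the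
imaginary mirror `L^{⟨zb⟩}`.  The FW input of g33's dévissage is supplied by the Literature reflection theorem
`classicalMuVanishes_of_isCyclotomic_of_imaginaryMirror_three`; the char-form `μ = 0` is g34's `_holds`.
[cite: CoatesSujatha2005, Cor. 3.6 (proof)] [cite: Wuthrich2014, Lemma 14 (p. 396)] [cite: Lang1990, Ch. 13 §2, Thm. 2.1 (i)]
[cite: Washington1997, §10.2 Thm. 10.10] -/
theorem fineSelmerInfty_torsion_finite_three_of_imaginaryMirror
    (W : WeierstrassCurve ℚ) [W.IsElliptic] (κ : ZpExtension ℚ 3) (hκ : κ.IsCyclotomic)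
    (C : AddSubgroup (W.geomTorsion ((3 : ℕ) : ℤ)))
    (hC : ∀ (σ : absoluteGaloisGroup ℚ) (x : W.geomTorsion ((3 : ℕ) : ℤ)), x ∈ C → σ • x ∈ C)
    (h1 : C ≠ ⊥) (h2 : C ≠ ⊤)
    [IsTotallyComplex ↥(W.borelField C)] (h3L : ¬ 3 ∣ Module.finrank ℚ ↥(W.borelField C))
    {ζ : ↥(W.borelField C)} (hζ : IsPrimitiveRoot ζ 3)
    {z b : ↥(W.borelField C) ≃ₐ[ℚ] ↥(W.borelField C)} (hz : z * z = 1) (hb : b * b = 1) (hzb : z * b = b * z)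
    (hz1 : z ≠ 1) (htop : Subgroup.closure ({z, b} : Set (↥(W.borelField C) ≃ₐ[ℚ] ↥(W.borelField C))) = ⊤)
    (hreal : IsTotallyReal ↥(fixedField (Subgroup.zpowers z)))
    [IsCyclotomicExtension {3} ℚ ↥(fixedField (Subgroup.zpowers b))]
    (hμ : ∀ κE : ZpExtension ↥(fixedField (Subgroup.zpowers (z * b))) 3, κE.IsCyclotomic → ClassicalMuVanishes κE) :
    (fineSelmerInfty (↥(W.geomTorsion ((3 : ℕ) : ℤ))) κ :
      Set (subgroupH1 κ.kerSubgroup (W.geomTorsion ((3 : ℕ) : ℤ)))).Finite := by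
  haveI : NeZero (3 : ℕ) := ⟨by decide⟩
  haveI : FiniteDimensional ℚ (W.borelField C) := finiteDimensional_borelField C
  haveI : IsGalois ℚ (W.borelField C) := isGalois_borelField hC
  haveI : NumberField (W.borelField C) := NumberField.mk
  refine ReducibleFineSelmerMuZeroCharForm.fineSelmerInfty_torsion_finite_of_reducible
    classicalMuVanishes_finite_unramifiedClasses_holds W (by decide) κ hκ C hC h1 h2 fun κF hκF => ?_
  exact classicalMuVanishes_of_isCyclotomic_of_imaginaryMirror_three ↥(W.borelField C) h3L hζ hz hb hzb hz1 htop hreal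
    hμ κF hκF

/-- **Coates–Sujatha's (A) at `(W, 3)` on a reducible row from `μ₃ = 0` of the imaginary quadratic mirror alone**, in the tree's
`∃ γ D, Module.Finite ℤ_[3] D.X` spelling (Lim–Sujatha bricks). [cite: CoatesSujatha2005, Cor. 3.6] [cite: Wuthrich2014, Lemma 14 (p. 396)]
[cite: Lang1990, Ch. 13 §2, Thm. 2.1 (i)] -/
theorem fineSelmerDual_moduleFinite_three_of_imaginaryMirror
    (W : WeierstrassCurve ℚ) [W.IsElliptic] (κ : ZpExtension ℚ 3) (hκ : κ.IsCyclotomic)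
    (C : AddSubgroup (W.geomTorsion ((3 : ℕ) : ℤ)))
    (hC : ∀ (σ : absoluteGaloisGroup ℚ) (x : W.geomTorsion ((3 : ℕ) : ℤ)), x ∈ C → σ • x ∈ C)
    (h1 : C ≠ ⊥) (h2 : C ≠ ⊤)
    [IsTotallyComplex ↥(W.borelField C)] (h3L : ¬ 3 ∣ Module.finrank ℚ ↥(W.borelField C))
    {ζ : ↥(W.borelField C)} (hζ : IsPrimitiveRoot ζ 3)
    {z b : ↥(W.borelField C) ≃ₐ[ℚ] ↥(W.borelField C)} (hz : z * z = 1) (hb : b * b = 1) (hzb : z * b = b * z)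
    (hz1 : z ≠ 1) (htop : Subgroup.closure ({z, b} : Set (↥(W.borelField C) ≃ₐ[ℚ] ↥(W.borelField C))) = ⊤)
    (hreal : IsTotallyReal ↥(fixedField (Subgroup.zpowers z)))
    [IsCyclotomicExtension {3} ℚ ↥(fixedField (Subgroup.zpowers b))]
    (hμ : ∀ κE : ZpExtension ↥(fixedField (Subgroup.zpowers (z * b))) 3, κE.IsCyclotomic → ClassicalMuVanishes κE) :
    ∃ (γ : absoluteGaloisGroup ℚ) (D : W.FineSelmerDualData κ γ),
      Module.Finite ℤ_[3] (RestrictScalars ℤ_[3] (IwasawaAlgebra 3) D.X) := by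
  rw [LimSujatha2018.fineSelmerDual_moduleFinite_iff_finite_fineSelmerInfty_torsion W (by decide) κ hκ]
  exact fineSelmerInfty_torsion_finite_three_of_imaginaryMirror W κ hκ C hC h1 h2 h3L hζ hz hb hzb hz1 htop hreal hμ

/-- **THE PER-ROW DOOR: (A) at `(W, 3)` from Iwasawa's 1956 criterion on the IMAGINARY QUADRATIC MIRROR alone** — `3 ∤ h(M)` and
exactly one prime of `M` above `3` (`3 ∤ #Cl(𝓞 M)` in the flavour-agnostic `Nat.card` spelling), `M = (borelField C)^{⟨zb⟩}` (`= ℚ(√δ)`, `δ` the negative one of `d, −3d`; the prime condition is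
automatic when `3 ∣ disc δ`, i.e. on the `χ_{−3d}` side).  No condition on the real mirror (where `3` may split), no Ferrero–Washington,
no growth theorem: Iwasawa 1956 (`_holds`) + reflection. [cite: Greenberg2001IwasawaPastPresent, Prop. 2.1 p. 339]
[cite: Washington1997, §10.2 Thm. 10.10 (Scholz)] [cite: CoatesSujatha2005, Cor. 3.6] -/
theorem fineSelmerDual_moduleFinite_three_of_imaginaryMirror_iwasawa1956
    (W : WeierstrassCurve ℚ) [W.IsElliptic] (κ : ZpExtension ℚ 3) (hκ : κ.IsCyclotomic)
    (C : AddSubgroup (W.geomTorsion ((3 : ℕ) : ℤ)))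
    (hC : ∀ (σ : absoluteGaloisGroup ℚ) (x : W.geomTorsion ((3 : ℕ) : ℤ)), x ∈ C → σ • x ∈ C)
    (h1 : C ≠ ⊥) (h2 : C ≠ ⊤)
    [IsTotallyComplex ↥(W.borelField C)] (h3L : ¬ 3 ∣ Module.finrank ℚ ↥(W.borelField C))
    {ζ : ↥(W.borelField C)} (hζ : IsPrimitiveRoot ζ 3)
    {z b : ↥(W.borelField C) ≃ₐ[ℚ] ↥(W.borelField C)} (hz : z * z = 1) (hb : b * b = 1) (hzb : z * b = b * z)
    (hz1 : z ≠ 1) (htop : Subgroup.closure ({z, b} : Set (↥(W.borelField C) ≃ₐ[ℚ] ↥(W.borelField C))) = ⊤)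
    (hreal : IsTotallyReal ↥(fixedField (Subgroup.zpowers z)))
    [IsCyclotomicExtension {3} ℚ ↥(fixedField (Subgroup.zpowers b))]
    (hh : ¬ 3 ∣ Nat.card (ClassGroup (𝓞 ↥(fixedField (Subgroup.zpowers (z * b))))))
    (hv : ∃! v : HeightOneSpectrum (𝓞 ↥(fixedField (Subgroup.zpowers (z * b)))),
      ((3 : ℕ) : 𝓞 ↥(fixedField (Subgroup.zpowers (z * b)))) ∈ v.asIdeal) :
    ∃ (γ : absoluteGaloisGroup ℚ) (D : W.FineSelmerDualData κ γ),
      Module.Finite ℤ_[3] (RestrictScalars ℤ_[3] (IwasawaAlgebra 3) D.X) := by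
  haveI : NeZero (3 : ℕ) := ⟨by decide⟩
  haveI : FiniteDimensional ℚ (W.borelField C) := finiteDimensional_borelField C
  haveI : NumberField (W.borelField C) := NumberField.mk
  haveI : NumberField ↥(fixedField (Subgroup.zpowers (z * b))) := NumberField.mk
  have hh' : ¬ 3 ∣ NumberField.classNumber ↥(fixedField (Subgroup.zpowers (z * b))) := by
    rwa [NumberField.classNumber, ← Nat.card_eq_fintype_card]
  exact fineSelmerDual_moduleFinite_three_of_imaginaryMirror W κ hκ C hC h1 h2 h3L hζ hz hb hzb hz1 htop hreal fun κE _ =>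
    classicalMuVanishes_of_classNumberPExp_eq_zero
      iwasawa1956_classNumberPExp_eq_zero_of_not_dvd_classNumber_of_unique_prime_holds hh' hv κE

end Summit.BirchSwinnertonDyer.BirchSwinnertonDyer.Theorems.ReducibleFineSelmerMirrorThree

end
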